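import Summits.QuantumFields.BalabanUV.T4Continuum.Support.ShellMeasureRootCompositionHistoriesSync
import Summits.QuantumFields.BalabanUV.T4Continuum.Support.ShellMeasureThresholdUnits

/-!
# `T4Continuum.ShellMeasureRootCompositionHistoriesFine` — γ8 END-TO-END on the END-I side: the END-I of record
# (`ShellMeasureRootCompositionHistoriesSync.shellWeightBound_histories_sync ∕ _age`) RE-KEYED TO END-II's FINE
# CURRENCY, the unit-change dictionary of the (R)+[dict] objects, and node U1b's `LocalRate` consumed BY NAME
(cell `pub-balaban`, sub-cell `t4`, spine estimate NE7c (node U5b); NE7c ROUND-2 crew `t4-ne7c-formalise-*`, unit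
`b2b-balaban-t4-ne7c-formalise-leaf-05` gen 9; journal OFFER «γ8 END-TO-END ON THE END-I SIDE» to the owner
`t4-ne7c-p1` gen 33 after its audit γ8 ∕ NOTE N-ne7cp1-g33-1 and row S90 `ShellMeasureThresholdUnits` (p229839);
ADDITIVE — imports this lineage's `ShellMeasureRootCompositionHistoriesSync` (p211878; hence files 1–2 of the histories
road and leaf-09's `ShellMeasureRootCompositionSync`) and the owner's S90 `ShellMeasureThresholdUnits` ONLY;
[folklore]; 0 `def`, 0 `def … : Prop`, 0 sorry, 0 citation tags)

HONEST FRAMING.  Finite four-torus programme, rung (B)+1 only — NOT infinite volume, NOT a mass gap, NOT the Clay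
problem, NOT summit progress; (B), `BetaPertHyp`, (B^μ) not consumed.  NE7c (`T4IndicatorShell.ShellWeightBound`) is
NOT PRINTED in [Balaban 1983–89] and NOT PROVED; END-I is the COMPOSITION «NE7c ⇐ the named binders» (trigger c3) and
this file, like files 1–4 of the histories road, discharges only BOOKKEEPING binders.  Nothing of the audited series is
asserted; the one equation number below ((2.17)) LOCATES the shape of an indicator, it is not a citation for a step.
HONEST DEPENDENCY (cell): continuum YM on T⁴ ⇐ BetaPertH ∧ nine spine estimates (0/9 proved); BetaPertH ⇐ (D1) ∧
(D4) ∧ CAP+tail; G-an2-4 gates asym, D1 and NE2/3/4.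

WHY THIS FILE (owner audit γ8, N-ne7cp1-g33-1).  The live-level END-II hosts (`ShellMeasureLandauEndFinal.…_final`,
`…EndRayStokesAssembled(Schwarz ∕ Decay).…_assembled…`) conclude (M1) in the FINE currency
`SlotAntiConcentration μ u (εθ·η²) ρ D` — RAW tested variable `u`, threshold `εθ·η²`, each run with ITS OWN fine scale
`η` (`η_j` in run A, `η_{j+1} = η_j∕L` in run B at the paired slot).  The END-I of record (file 4
`shellWeightBound_histories_sync` ∕ its D8 instance `shellWeightBound_histories_age`) takes per-slot (M1) and the a.e.
closeness for ONE pair of tested variables against ONE threshold per slot — which, by the owner's S90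
(`slotAntiConcentration_fine_iff`, `fineCurrency_closeness_fails`), is the η²-NORMALISED pair in THRESHOLD UNITS.  S90
lands the per-slot LEMMAS of that junction; this file fires the END itself in those units, so that (i) END-II's
conclusions plug into `hacA`∕`hacB` TOKEN FOR TOKEN (raw variable, threshold `θ_{K,s}·η²`, the realized measure in the
raw currency — modulo the [dict] node-O identification of the slot measure with the `s`-small partial law, displayed as
before), (ii) the closeness binder is read in threshold units, and (iii) node U1b's `T4EtaRateMin.LocalRate` discharges
it BY NAME (§3), with the width `ρ := T4SupCloseLiaison.geomWidth` and END-I's rate binder AUTOMATIC.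

WHAT IS PROVED ([folklore] bookkeeping; every item is one call of S90 or of files 1∕4 of the histories road).
* §1 THE UNIT-CHANGE DICTIONARY OF THE (R)+[dict] OBJECTS.  For raw tested variables `v s` and positive scales `η s`:
  `smallInd (v∕η²) ϑ = smallInd v (ϑ·η²)` (`smallInd_fine` — B14 (2.17)'s `χ(|U_{k,□}(∂p) − 1| < ε_kη²)` IS the
  raw-currency indicator: the LOCATOR of the shape), hence `smallProd_fine`, `histWeight_fine`, `histLaw_fine`,
  `partialLaw_fine`, `histPiece_fine`: the histories-road objects of the NORMALISED variables at thresholds `ϑ` ARE the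
  same objects of the RAW variables at the FINE thresholds `ϑ·η²`; `histShell_fine`: the two-run shell part of the
  normalised pair is the MIXED raw form `∫ smallProd^A_{ϑ·ηA²}·(1 − smallProd^B_{ϑ·ηB²}) dν` (two runs, two scales — the
  one object for which only threshold units give ONE threshold); `slotAC_partialLaw_fine_iff`: (M1) for the raw
  variable at `ϑ_s·η_s²` under the raw-currency partial law ⟺ (M1) for the normalised variable at `ϑ_s` under the
  normalised-currency partial law (S90 §1 ∘ `partialLaw_fine`).
* §2 **`shellWeightBound_histories_fine_sync`** — file 4's `shellWeightBound_histories_sync` (thresholds BY SLOT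
  `θ K s`) with `uA := vA∕ηA²`, `uB := vB∕ηB²` for free positive scale assignments `ηA ηB : ℕ → σ → ℝ`, its `hacA`∕`hacB`
  REWRITTEN into END-II's literal currency («(M1) for the RAW variable `vA K t s` at threshold `θ K s·(ηA K s)²` under
  the RAW-currency partial law»), `hcloseA`∕`hcloseB` in THRESHOLD UNITS (`|vA∕ηA² − vB∕ηB²| ≤ ρ_{lvl s}·θ K s` a.e.
  under each history measure in which `s` is live-small), every other binder VERBATIM; conclusion LITERALLY
  `T4IndicatorShell.ShellWeightBound l₀ T A B shA shB Wsh` with `A`∕`B` the RAW-currency history weights at the fine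
  thresholds and the same `Wsh K = Σ_{s∈C K} D^A_{lvl s}ρ_{lvl s} + Σ_{s∈C K} D^B_{lvl s}ρ_{lvl s}`;
  **`shellWeightBound_histories_fine_age`** — the D8 instance `θ K s := ε (K − lvl K s)` (file 4's
  `shellWeightBound_histories_age` in the fine currency; scales typically `ηA K s := η (lvl K s)`,
  `ηB K s := η (lvl K s + 1)`, N-ne7cp1-g33-1 (1) — kept FREE here).
* §3 **`shellWeightBound_histories_fine_of_localRate`** — §2's age instance with `hcloseA`∕`hcloseB` DISCHARGED from
  node U1b's `LocalRate R Cr ϑ` + the a.e. REALISATION IDENTITIES «`vA∕ηA² = R.loc (lvl K s) V x`,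
  `vB∕ηB² = R.loc (lvl K s + 1) V x`» (`T4SupCloseLiaison.ReadsLevels` TYPE, in END-I's indexing; UNPRINTED data
  identities, displayed, never asserted) + the floor `θmin ≤ ε a` on the age window (`LiveWindow.recent`) — S90
  `hclose_of_localRate` ∕ `floor_of_ageWindow` BY NAME; `ρ := geomWidth Cr θmin ϑ`, `hrate` = `geomWidth_le_rate`
  (`c₁ = Cr∕θmin`), `hρ0` = `geomWidth_nonneg`.  THE γ8 JUNCTION AS ONE THEOREM: `ShellWeightBound` ⇐ fine-currency (M1)
  per slot per run (THE WALL, END-II's output shape) ∧ `LocalRate` (node U1b, c4) ∧ realisation identities ∧ floor ∧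
  (W1) window ∧ `D ≤ D̄`.
* §4 NON-VACUITY (trigger c3 ∕ rule G-1 spirit; the binder family is measure-theoretic, not geometric): on the unit
  interval with Lebesgue measure, ONE slot per comparison index, run A's raw variable `ω` at scale `1` and run B's raw
  variable `ω∕4` at scale `1∕2` (the owner's §4 scenario: RAW variables `L² = 4` apart, NORMALISED variables equal),
  every binder of §2 is inhabited and the END fires (`toy_shellWeightBound_fine`); the raw closeness would have to
  bound `|ω − ω∕4| = 3ω∕4`, which is NOT small on the interval (`toy_raw_closeness_fails`).
DISPLAYED, NEVER MINTED (c2): (M1) per slot per run (the wall — at live levels END-II's binders SM-L1…SM-L6), the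
[dict] node-O identification of END-II's realized measure with the partial law, the window∕count (S9), node U1b's
`LocalRate` and the realisation identities (c4), the profile `ε` and the scales `η`.  NOTHING in the countdown moves;
NE7c NOT PROVED; spine PROVED 0∕9.
-/

noncomputable section

open MeasureTheory Finset Filter Set
open scoped ENNReal

namespace Summit.QuantumFields.BalabanUV.T4Continuum.ShellMeasureRootCompositionHistoriesFine

open Literature.MathematicalPhysics.QuantumFieldTheory.Balaban1983to89
open ShellMeasureRootCompositionHistories
open ShellMeasureRootCompositionHistoriesSync (shellWeightBound_histories_sync)
open ShellMeasureThresholdUnits (slotAntiConcentration_fine_iff hclose_of_localRate floor_of_ageWindow)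
open T4IndicatorShell (ShellWeightBound smallInd)
open T4ShellMeasure (SlotAntiConcentration)
open T4ShellMeasureLevels (LiveWindow)
open T4EtaRateMin (Readings LocalRate)
open T4SupCloseLiaison (geomWidth geomWidth_nonneg geomWidth_le_rate)

/-! ## §1 The unit-change dictionary of the (R)+[dict] objects -/

section Dictionary

variable {Ω σ ι : Type*}

/-- **THE RAW-CURRENCY INDICATOR**: for `η > 0`, `χ_ϑ(v∕η²) = χ_{ϑ·η²}(v)` — the small-field indicator of the
η²-normalised variable at the age threshold IS the indicator of the raw variable at the fine threshold (the shape
B14 (2.17) displays, `χ(|U_{k,□}(∂p) − 1| < ε_kη²)`; locator only). [folklore] -/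
theorem smallInd_fine (v ϑ : ℝ) {η : ℝ} (hη : 0 < η) : smallInd (v / η ^ 2) ϑ = smallInd v (ϑ * η ^ 2) := by
  unfold smallInd; simp only [div_lt_iff₀ (pow_pos hη 2)]

/-- the live small-field indicator PRODUCT of a history, normalised variables at thresholds `ϑ` = raw variables at
thresholds `ϑ·η²`. [folklore] -/
theorem smallProd_fine (sm : Finset σ) (v : σ → Ω → ℝ) (ϑ η : σ → ℝ) (hη : ∀ s, 0 < η s) (ω : Ω) :
    smallProd sm (fun s ω => v s ω / η s ^ 2) ϑ ω = smallProd sm v (fun s => ϑ s * η s ^ 2) ω := by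
  unfold smallProd; exact Finset.prod_congr rfl fun s _ => smallInd_fine _ _ (hη s)

variable [MeasurableSpace Ω]

/-- the history WEIGHT in the two currencies agrees. [folklore] -/
theorem histWeight_fine (ν : Measure Ω) (sm : Finset σ) (v : σ → Ω → ℝ) (ϑ η : σ → ℝ) (hη : ∀ s, 0 < η s) :
    histWeight ν sm (fun s ω => v s ω / η s ^ 2) ϑ = histWeight ν sm v (fun s => ϑ s * η s ^ 2) := by
  unfold histWeight; exact integral_congr_ae (Eventually.of_forall fun ω => smallProd_fine sm v ϑ η hη ω)

/-- the history's LAW in the two currencies agrees. [folklore] -/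
theorem histLaw_fine (ν : Measure Ω) (sm : Finset σ) (v : σ → Ω → ℝ) (ϑ η : σ → ℝ) (hη : ∀ s, 0 < η s) :
    histLaw ν sm (fun s ω => v s ω / η s ^ 2) ϑ = histLaw ν sm v (fun s => ϑ s * η s ^ 2) := by
  unfold histLaw; congr 1; funext ω; rw [smallProd_fine sm v ϑ η hη ω]

/-- **THE `s`-SMALL PARTIAL LAW in the two currencies agrees** (the realized measure END-I's `hac` weighs). [folklore] -/
theorem partialLaw_fine [DecidableEq σ] (T : Finset ι) (ν : ι → Measure Ω) (small : ι → Finset σ) (v : σ → Ω → ℝ)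
    (ϑ η : σ → ℝ) (hη : ∀ s, 0 < η s) (s : σ) :
    partialLaw T ν small (fun s ω => v s ω / η s ^ 2) ϑ s = partialLaw T ν small v (fun s => ϑ s * η s ^ 2) s := by
  unfold partialLaw; exact Finset.sum_congr rfl fun τ _ => histLaw_fine (ν τ) (small τ) v ϑ η hη

/-- the SHELL PART of a history for the normalised pair is the MIXED raw form: run A's indicators at `ϑ·ηA²`, run B's at
`ϑ·ηB²` (two runs, two scales). [folklore] -/
theorem histShell_fine (ν : Measure Ω) (sm : Finset σ) (vA vB : σ → Ω → ℝ) (ϑ ηA ηB : σ → ℝ) (hA : ∀ s, 0 < ηA s)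
    (hB : ∀ s, 0 < ηB s) :
    histShell ν sm (fun s ω => vA s ω / ηA s ^ 2) (fun s ω => vB s ω / ηB s ^ 2) ϑ =
      ∫ ω, smallProd sm vA (fun s => ϑ s * ηA s ^ 2) ω * (1 - smallProd sm vB (fun s => ϑ s * ηB s ^ 2) ω) ∂ν := by
  unfold histShell
  exact integral_congr_ae (Eventually.of_forall fun ω => by
    simp only [smallProd_fine sm vA ϑ ηA hA ω, smallProd_fine sm vB ϑ ηB hB ω])

/-- the PIECE of slot `s` in a history, mixed raw form. [folklore] -/
theorem histPiece_fine [DecidableEq σ] (ν : Measure Ω) (sm : Finset σ) (vA vB : σ → Ω → ℝ) (ϑ ηA ηB : σ → ℝ)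
    (hA : ∀ s, 0 < ηA s) (hB : ∀ s, 0 < ηB s) (s : σ) :
    histPiece ν sm (fun s ω => vA s ω / ηA s ^ 2) (fun s ω => vB s ω / ηB s ^ 2) ϑ s =
      if s ∈ sm then ∫ ω, smallProd sm vA (fun s => ϑ s * ηA s ^ 2) ω *
        (1 - smallInd (vB s ω) (ϑ s * ηB s ^ 2)) ∂ν else 0 := by
  unfold histPiece; split_ifs
  · exact integral_congr_ae (Eventually.of_forall fun ω => by
      simp only [smallProd_fine sm vA ϑ ηA hA ω, smallInd_fine _ _ (hB s)])
  · rfl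

/-- **(M1) FOR THE PARTIAL LAW IN THE TWO CURRENCIES** (S90 §1 ∘ `partialLaw_fine`): (M1) for the RAW variable `v s`
at the fine threshold `ϑ_s·η_s²` under the raw-currency partial law ⟺ (M1) for the NORMALISED variable `v s∕η_s²` at
`ϑ_s` under the normalised-currency partial law — same `ρ`, same `D`. [folklore] -/
theorem slotAC_partialLaw_fine_iff [DecidableEq σ] (T : Finset ι) (ν : ι → Measure Ω) (small : ι → Finset σ)
    (v : σ → Ω → ℝ) (ϑ η : σ → ℝ) (hη : ∀ s, 0 < η s) (s : σ) (ρ D : ℝ) :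
    SlotAntiConcentration (partialLaw T ν small v (fun s => ϑ s * η s ^ 2) s) (v s) (ϑ s * η s ^ 2) ρ D ↔
      SlotAntiConcentration (partialLaw T ν small (fun s ω => v s ω / η s ^ 2) ϑ s) (fun ω => v s ω / η s ^ 2)
        (ϑ s) ρ D := by
  rw [partialLaw_fine T ν small v ϑ η hη s, slotAntiConcentration_fine_iff (hη s)]

end Dictionary

/-! ## §2 END-I of record fired in the fine currency -/

section TwoRuns

variable {Ω : ℕ → Type*} [∀ K, MeasurableSpace (Ω K)] {σ ι : Type*} [DecidableEq σ] {T : ℕ → Finset ι}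
  {C : ℕ → Finset σ} {small : ℕ → ι → Finset σ} {lvl : ℕ → σ → ℕ} {νA νB : ∀ K : ℕ, ℝ → ι → Measure (Ω K)}
  [∀ K t τ, IsFiniteMeasure (νA K t τ)] [∀ K t τ, IsFiniteMeasure (νB K t τ)]
  {vA vB : ∀ K : ℕ, ℝ → σ → Ω K → ℝ} {θ ηA ηB : ℕ → σ → ℝ} {ρ DA DB : ℕ → ℝ} {l₀ : ℝ} {N₁ : ℕ}
  {νbar Dbar c₁ ϑ : ℝ}

/-- **END-I FOR HISTORY-INDEXED TERMS IN END-II's FINE CURRENCY, THRESHOLDS BY SLOT.**  File 4's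
`shellWeightBound_histories_sync` for the η²-NORMALISED tested variables `vA∕ηA²`, `vB∕ηB²` (scales
`ηA ηB : ℕ → σ → ℝ`, positive, free), with: `hacA`∕`hacB` = (M1) per slot per run for the RAW variable at the FINE
threshold `θ K s·η²` under the RAW-currency `s`-small partial law — LITERALLY the currency of the END-II hosts'
conclusion `SlotAntiConcentration μ u (εθ·η²) ρ D` (THE WALL, displayed); `hcloseA`∕`hcloseB` = a.e. closeness of the
normalised variables in THRESHOLD UNITS under every history measure in which the slot is live-small (node U1b TYPE,
displayed — §3 discharges it from `LocalRate`); measurability of the raw variables, `small ⊆ C`, signs, the window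
`LiveWindow C lvl N₁ ν̄` (SM-L7), `D ≤ D̄`, the rate `ρ_j ≤ c₁ϑ^j` (SM-L8) VERBATIM.  CONCLUSION: LITERALLY
`T4IndicatorShell.ShellWeightBound l₀ T A B shA shB Wsh` with `A`∕`B` the RAW-currency history weights at the fine
thresholds, `shA`∕`shB` the shell parts of the normalised pairs (= the mixed raw forms, `histShell_fine`) and END-I's
`Wsh K = Σ_{s∈C K} D^A_{lvl s}ρ_{lvl s} + Σ_{s∈C K} D^B_{lvl s}ρ_{lvl s}`.  CONDITIONAL; nothing printed asserted.
[folklore] -/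
theorem shellWeightBound_histories_fine_sync (hvA : ∀ K t s, Measurable (vA K t s))
    (hvB : ∀ K t s, Measurable (vB K t s)) (hηA : ∀ K s, 0 < ηA K s) (hηB : ∀ K s, 0 < ηB K s)
    (hsmall : ∀ K, ∀ τ ∈ T K, small K τ ⊆ C K)
    (hcloseA : ∀ K t, |t| ≤ l₀ → ∀ τ ∈ T K, ∀ s ∈ small K τ,
      ∀ᵐ ω ∂(νA K t τ), |vA K t s ω / ηA K s ^ 2 - vB K t s ω / ηB K s ^ 2| ≤ ρ (lvl K s) * θ K s)
    (hcloseB : ∀ K t, |t| ≤ l₀ → ∀ τ ∈ T K, ∀ s ∈ small K τ,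
      ∀ᵐ ω ∂(νB K t τ), |vB K t s ω / ηB K s ^ 2 - vA K t s ω / ηA K s ^ 2| ≤ ρ (lvl K s) * θ K s)
    (hDA0 : ∀ j, 0 ≤ DA j) (hDB0 : ∀ j, 0 ≤ DB j) (hρ0 : ∀ j, 0 ≤ ρ j)
    (hacA : ∀ K t, |t| ≤ l₀ → ∀ s ∈ C K,
      SlotAntiConcentration (partialLaw (T K) (νA K t) (small K) (vA K t) (fun s => θ K s * ηA K s ^ 2) s)
        (vA K t s) (θ K s * ηA K s ^ 2) (ρ (lvl K s)) (DA (lvl K s)))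
    (hacB : ∀ K t, |t| ≤ l₀ → ∀ s ∈ C K,
      SlotAntiConcentration (partialLaw (T K) (νB K t) (small K) (vB K t) (fun s => θ K s * ηB K s ^ 2) s)
        (vB K t s) (θ K s * ηB K s ^ 2) (ρ (lvl K s)) (DB (lvl K s)))
    (hw : LiveWindow C lvl N₁ νbar) (hϑ0 : 0 < ϑ) (hϑ1 : ϑ < 1)
    (hDA : ∀ j, DA j ≤ Dbar) (hDB : ∀ j, DB j ≤ Dbar) (hrate : ∀ j, ρ j ≤ c₁ * ϑ ^ j) :
    ShellWeightBound l₀ T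
      (fun K t τ => histWeight (νA K t τ) (small K τ) (vA K t) (fun s => θ K s * ηA K s ^ 2))
      (fun K t τ => histWeight (νB K t τ) (small K τ) (vB K t) (fun s => θ K s * ηB K s ^ 2))
      (fun K t τ => histShell (νA K t τ) (small K τ) (fun s ω => vA K t s ω / ηA K s ^ 2)
        (fun s ω => vB K t s ω / ηB K s ^ 2) (θ K))
      (fun K t τ => histShell (νB K t τ) (small K τ) (fun s ω => vB K t s ω / ηB K s ^ 2)
        (fun s ω => vA K t s ω / ηA K s ^ 2) (θ K))
      (fun K => ∑ s ∈ C K, DA (lvl K s) * ρ (lvl K s) + ∑ s ∈ C K, DB (lvl K s) * ρ (lvl K s)) := by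
  have h := shellWeightBound_histories_sync (T := T) (C := C) (small := small) (lvl := lvl) (νA := νA) (νB := νB)
    (uA := fun K t s ω => vA K t s ω / ηA K s ^ 2) (uB := fun K t s ω => vB K t s ω / ηB K s ^ 2) (θ := θ)
    (ρ := ρ) (DA := DA) (DB := DB) (l₀ := l₀) (N₁ := N₁) (νbar := νbar) (Dbar := Dbar) (c₁ := c₁) (ϑ := ϑ)
    (fun K t s => (hvA K t s).div_const _) (fun K t s => (hvB K t s).div_const _) hsmall hcloseA hcloseB hDA0 hDB0
    hρ0 (fun K t ht s hs => (slotAC_partialLaw_fine_iff (T K) (νA K t) (small K) (vA K t) (θ K) (ηA K) (hηA K) s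
      _ _).1 (hacA K t ht s hs))
    (fun K t ht s hs => (slotAC_partialLaw_fine_iff (T K) (νB K t) (small K) (vB K t) (θ K) (ηB K) (hηB K) s
      _ _).1 (hacB K t ht s hs)) hw hϑ0 hϑ1 hDA hDB hrate
  have hWA : (fun K t τ => histWeight (νA K t τ) (small K τ) (fun s ω => vA K t s ω / ηA K s ^ 2) (θ K)) =
      fun K t τ => histWeight (νA K t τ) (small K τ) (vA K t) (fun s => θ K s * ηA K s ^ 2) := by
    funext K t τ; exact histWeight_fine (νA K t τ) (small K τ) (vA K t) (θ K) (ηA K) (hηA K)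
  have hWB : (fun K t τ => histWeight (νB K t τ) (small K τ) (fun s ω => vB K t s ω / ηB K s ^ 2) (θ K)) =
      fun K t τ => histWeight (νB K t τ) (small K τ) (vB K t) (fun s => θ K s * ηB K s ^ 2) := by
    funext K t τ; exact histWeight_fine (νB K t τ) (small K τ) (vB K t) (θ K) (ηB K) (hηB K)
  rw [hWA, hWB] at h; exact h

/-- **THE D8 INSTANCE IN THE FINE CURRENCY — thresholds by AGE `ε (K − lvl K s)`** (file 4's
`shellWeightBound_histories_age` re-keyed): run A's slot `s` is tested RAW at `ε(K − lvl K s)·ηA K s²`, run B's at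
`ε(K − lvl K s)·ηB K s²` (N-ne7cp1-g33-1 (1): typically `ηA K s = η_{lvl K s} = L^{−lvl K s}` and
`ηB K s = η_{lvl K s + 1} = ηA K s∕L` — kept FREE), the closeness binder reads in threshold units against the AGE
threshold.  CONDITIONAL; nothing printed asserted. [folklore] -/
theorem shellWeightBound_histories_fine_age {ε : ℕ → ℝ} (hvA : ∀ K t s, Measurable (vA K t s))
    (hvB : ∀ K t s, Measurable (vB K t s)) (hηA : ∀ K s, 0 < ηA K s) (hηB : ∀ K s, 0 < ηB K s)
    (hsmall : ∀ K, ∀ τ ∈ T K, small K τ ⊆ C K)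
    (hcloseA : ∀ K t, |t| ≤ l₀ → ∀ τ ∈ T K, ∀ s ∈ small K τ,
      ∀ᵐ ω ∂(νA K t τ), |vA K t s ω / ηA K s ^ 2 - vB K t s ω / ηB K s ^ 2| ≤ ρ (lvl K s) * ε (K - lvl K s))
    (hcloseB : ∀ K t, |t| ≤ l₀ → ∀ τ ∈ T K, ∀ s ∈ small K τ,
      ∀ᵐ ω ∂(νB K t τ), |vB K t s ω / ηB K s ^ 2 - vA K t s ω / ηA K s ^ 2| ≤ ρ (lvl K s) * ε (K - lvl K s))
    (hDA0 : ∀ j, 0 ≤ DA j) (hDB0 : ∀ j, 0 ≤ DB j) (hρ0 : ∀ j, 0 ≤ ρ j)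
    (hacA : ∀ K t, |t| ≤ l₀ → ∀ s ∈ C K,
      SlotAntiConcentration
        (partialLaw (T K) (νA K t) (small K) (vA K t) (fun s => ε (K - lvl K s) * ηA K s ^ 2) s)
        (vA K t s) (ε (K - lvl K s) * ηA K s ^ 2) (ρ (lvl K s)) (DA (lvl K s)))
    (hacB : ∀ K t, |t| ≤ l₀ → ∀ s ∈ C K,
      SlotAntiConcentration
        (partialLaw (T K) (νB K t) (small K) (vB K t) (fun s => ε (K - lvl K s) * ηB K s ^ 2) s)
        (vB K t s) (ε (K - lvl K s) * ηB K s ^ 2) (ρ (lvl K s)) (DB (lvl K s)))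
    (hw : LiveWindow C lvl N₁ νbar) (hϑ0 : 0 < ϑ) (hϑ1 : ϑ < 1)
    (hDA : ∀ j, DA j ≤ Dbar) (hDB : ∀ j, DB j ≤ Dbar) (hrate : ∀ j, ρ j ≤ c₁ * ϑ ^ j) :
    ShellWeightBound l₀ T
      (fun K t τ => histWeight (νA K t τ) (small K τ) (vA K t) (fun s => ε (K - lvl K s) * ηA K s ^ 2))
      (fun K t τ => histWeight (νB K t τ) (small K τ) (vB K t) (fun s => ε (K - lvl K s) * ηB K s ^ 2))
      (fun K t τ => histShell (νA K t τ) (small K τ) (fun s ω => vA K t s ω / ηA K s ^ 2)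
        (fun s ω => vB K t s ω / ηB K s ^ 2) (fun s => ε (K - lvl K s)))
      (fun K t τ => histShell (νB K t τ) (small K τ) (fun s ω => vB K t s ω / ηB K s ^ 2)
        (fun s ω => vA K t s ω / ηA K s ^ 2) (fun s => ε (K - lvl K s)))
      (fun K => ∑ s ∈ C K, DA (lvl K s) * ρ (lvl K s) + ∑ s ∈ C K, DB (lvl K s) * ρ (lvl K s)) :=
  shellWeightBound_histories_fine_sync (θ := fun K s => ε (K - lvl K s)) hvA hvB hηA hηB hsmall hcloseA hcloseB hDA0
    hDB0 hρ0 hacA hacB hw hϑ0 hϑ1 hDA hDB hrate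

/-! ## §3 The closeness binder discharged by node U1b's `LocalRate` BY NAME -/

/-- **THE γ8 JUNCTION AS ONE THEOREM: `ShellWeightBound` ⇐ FINE-CURRENCY (M1) PER SLOT PER RUN ∧ node U1b's
`LocalRate` ∧ REALISATION IDENTITIES ∧ FLOOR ∧ WINDOW ∧ `D ≤ D̄`.**  §2's age instance with the closeness binders
DISCHARGED: a reading family `R : T4EtaRateMin.Readings Dat Sit` with `LocalRate R Cr ϑ` (node U1b ∕ NE3 — NOT this
node's estimate, consumed BY NAME, trigger c4), `0 ≤ Cr`, `0 < ϑ < 1`; the a.e. REALISATION IDENTITIES under every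
history measure of either run in which the slot is live-small — run A's normalised variable IS the `lvl K s`-step local
reading and run B's IS the `(lvl K s + 1)`-step local reading of `R` at a common admissible datum and site
(`T4SupCloseLiaison.ReadsLevels` TYPE in END-I's indexing; UNPRINTED data identities, displayed, never asserted); the
floor `θmin ≤ ε a` for ages `a ≤ N₁` (`0 < θmin`; `T4SupCloseLiaison.thresholdFloor_of_ageLower_window` TYPE).  Then
S90 `hclose_of_localRate` gives `hcloseA`∕`hcloseB` with the width `ρ := geomWidth Cr θmin ϑ` (the age bound
`K − lvl K s ≤ N₁` from `LiveWindow.recent`), END-I's rate binder holds by `geomWidth_le_rate` (`c₁ = Cr∕θmin`) and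
`hρ0` by `geomWidth_nonneg`.  What stays displayed: THE WALL (fine-currency (M1) per slot per run), `LocalRate`, the
identities, the floor, the window, `D ≤ D̄`, the profile `ε`, the scales.  CONDITIONAL; nothing printed asserted; NE7c
NOT PROVED. [folklore] -/
theorem shellWeightBound_histories_fine_of_localRate {ε : ℕ → ℝ} {Dat Sit : Type*} {R : Readings Dat Sit}
    {Cr θmin : ℝ} (hvA : ∀ K t s, Measurable (vA K t s)) (hvB : ∀ K t s, Measurable (vB K t s))
    (hηA : ∀ K s, 0 < ηA K s) (hηB : ∀ K s, 0 < ηB K s) (hsmall : ∀ K, ∀ τ ∈ T K, small K τ ⊆ C K)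
    -- node U1b BY NAME: the local rate, the realisation identities, the floor on the age profile
    (hloc : LocalRate R Cr ϑ) (hCr : 0 ≤ Cr) (hmin : 0 < θmin) (hfloor : ∀ a ≤ N₁, θmin ≤ ε a)
    (hRA : ∀ K t, |t| ≤ l₀ → ∀ τ ∈ T K, ∀ s ∈ small K τ, ∀ᵐ ω ∂(νA K t τ), ∃ V ∈ R.dom, ∃ x : Sit,
      vA K t s ω / ηA K s ^ 2 = R.loc (lvl K s) V x ∧ vB K t s ω / ηB K s ^ 2 = R.loc (lvl K s + 1) V x)
    (hRB : ∀ K t, |t| ≤ l₀ → ∀ τ ∈ T K, ∀ s ∈ small K τ, ∀ᵐ ω ∂(νB K t τ), ∃ V ∈ R.dom, ∃ x : Sit,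
      vA K t s ω / ηA K s ^ 2 = R.loc (lvl K s) V x ∧ vB K t s ω / ηB K s ^ 2 = R.loc (lvl K s + 1) V x)
    (hDA0 : ∀ j, 0 ≤ DA j) (hDB0 : ∀ j, 0 ≤ DB j)
    -- THE WALL: (M1) per slot per run, END-II's fine currency
    (hacA : ∀ K t, |t| ≤ l₀ → ∀ s ∈ C K,
      SlotAntiConcentration
        (partialLaw (T K) (νA K t) (small K) (vA K t) (fun s => ε (K - lvl K s) * ηA K s ^ 2) s)
        (vA K t s) (ε (K - lvl K s) * ηA K s ^ 2) (geomWidth Cr θmin ϑ (lvl K s)) (DA (lvl K s)))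
    (hacB : ∀ K t, |t| ≤ l₀ → ∀ s ∈ C K,
      SlotAntiConcentration
        (partialLaw (T K) (νB K t) (small K) (vB K t) (fun s => ε (K - lvl K s) * ηB K s ^ 2) s)
        (vB K t s) (ε (K - lvl K s) * ηB K s ^ 2) (geomWidth Cr θmin ϑ (lvl K s)) (DB (lvl K s)))
    (hw : LiveWindow C lvl N₁ νbar) (hϑ0 : 0 < ϑ) (hϑ1 : ϑ < 1) (hDA : ∀ j, DA j ≤ Dbar)
    (hDB : ∀ j, DB j ≤ Dbar) :
    ShellWeightBound l₀ T
      (fun K t τ => histWeight (νA K t τ) (small K τ) (vA K t) (fun s => ε (K - lvl K s) * ηA K s ^ 2))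
      (fun K t τ => histWeight (νB K t τ) (small K τ) (vB K t) (fun s => ε (K - lvl K s) * ηB K s ^ 2))
      (fun K t τ => histShell (νA K t τ) (small K τ) (fun s ω => vA K t s ω / ηA K s ^ 2)
        (fun s ω => vB K t s ω / ηB K s ^ 2) (fun s => ε (K - lvl K s)))
      (fun K t τ => histShell (νB K t τ) (small K τ) (fun s ω => vB K t s ω / ηB K s ^ 2)
        (fun s ω => vA K t s ω / ηA K s ^ 2) (fun s => ε (K - lvl K s)))
      (fun K => ∑ s ∈ C K, DA (lvl K s) * geomWidth Cr θmin ϑ (lvl K s) +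
        ∑ s ∈ C K, DB (lvl K s) * geomWidth Cr θmin ϑ (lvl K s)) := by
  have hage : ∀ K, ∀ τ ∈ T K, ∀ s ∈ small K τ, θmin ≤ ε (K - lvl K s) := fun K τ hτ s hs =>
    floor_of_ageWindow (j := lvl K s) (by have h := hw.recent K s (hsmall K τ hτ hs); omega) hfloor
  refine shellWeightBound_histories_fine_age (ρ := geomWidth Cr θmin ϑ) (c₁ := Cr / θmin) hvA hvB hηA hηB hsmall
    (fun K t ht τ hτ s hs => ?_) (fun K t ht τ hτ s hs => ?_) hDA0 hDB0
    (fun j => geomWidth_nonneg hCr hmin.le hϑ0.le j) hacA hacB hw hϑ0 hϑ1 hDA hDB (geomWidth_le_rate Cr θmin ϑ)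
  · -- run A's histories: S90 `hclose_of_localRate` BY NAME
    exact hclose_of_localRate (rA := fun ω => vA K t s ω / ηA K s ^ 2) (rB := fun ω => vB K t s ω / ηB K s ^ 2)
      hloc (hRA K t ht τ hτ s hs) hmin (hage K τ hτ s hs)
  · -- run B's histories: the same, then `|b − a| = |a − b|`
    have h := hclose_of_localRate (rA := fun ω => vA K t s ω / ηA K s ^ 2)
      (rB := fun ω => vB K t s ω / ηB K s ^ 2) hloc (hRB K t ht τ hτ s hs) hmin (hage K τ hτ s hs)
    filter_upwards [h] with ω hω; rwa [abs_sub_comm]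

end TwoRuns

/-! ## §4 Non-vacuity: the two-scale toy (trigger c3; rule G-1 spirit) -/

section Toy

/-- the unit interval under Lebesgue measure carries a finite measure. [folklore] -/
theorem isFiniteMeasure_unitInterval : IsFiniteMeasure ((volume : Measure ℝ).restrict (Icc (0 : ℝ) 1)) :=
  isFiniteMeasure_restrict.2 (by rw [Real.volume_Icc]; exact ENNReal.ofReal_ne_top)

/-- WIDTH `0`: the shell `{θ·(1 − 0) ≤ u < θ}` is EMPTY, so (M1) holds for every measure, variable, threshold and
constant (the degenerate (M1) the toy uses — two runs EXACTLY synchronised in threshold units; cf. S90 §5). [folklore] -/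
theorem slotAntiConcentration_width_zero {Ω' : Type*} [MeasurableSpace Ω'] (μ : Measure Ω') (u : Ω' → ℝ) (θ D : ℝ) :
    SlotAntiConcentration μ u θ 0 D := by
  unfold SlotAntiConcentration
  have : {x | θ * (1 - 0) ≤ u x ∧ u x < θ} = ∅ := by
    ext x; simp only [sub_zero, mul_one, mem_setOf_eq, mem_empty_iff_false, iff_false, not_and, not_lt]; exact id
  rw [this, measure_empty]; exact bot_le

/-- **THE TWO-SCALE TOY: EVERY BINDER OF §2 JOINTLY INHABITED, AND THE END FIRES.**  Unit interval with Lebesgue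
measure; ONE term and ONE slot per comparison index (`T K = C K = small K τ = {()}`, NONEMPTY), level `lvl K () = K`
(age `0`), window depth `N₁ = 0`, count `ν̄ = 1`; run A's RAW variable `ω` at scale `ηA = 1`, run B's RAW variable `ω∕4`
at scale `ηB = 1∕2` — the owner's S90 §4 scenario: the raw variables are `L² = 4` apart, the NORMALISED variables
`ω∕1²` and `(ω∕4)∕(1∕2)²` COINCIDE, so the threshold-unit closeness holds with width `ρ ≡ 0` (rate `0·(1∕2)^j`), (M1)
per slot per run holds with `D ≡ 0` (empty shell, `slotAntiConcentration_width_zero`), age profile `ε ≡ 1`; the END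
§2 `shellWeightBound_histories_fine_age` FIRES with `Wsh ≡ 0`.  A consistency certificate of OUR binder family;
nothing of Bałaban's. [folklore] -/
theorem toy_shellWeightBound_fine :
    ShellWeightBound 1 (fun _ : ℕ => ({()} : Finset Unit))
      (fun _ _ _ => histWeight ((volume : Measure ℝ).restrict (Icc (0 : ℝ) 1)) ({()} : Finset Unit)
        (fun _ ω => ω) fun _ => (1 : ℝ) * (1 : ℝ) ^ 2)
      (fun _ _ _ => histWeight ((volume : Measure ℝ).restrict (Icc (0 : ℝ) 1)) ({()} : Finset Unit)
        (fun _ ω => ω / 4) fun _ => (1 : ℝ) * (1 / 2 : ℝ) ^ 2)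
      (fun _ _ _ => histShell ((volume : Measure ℝ).restrict (Icc (0 : ℝ) 1)) ({()} : Finset Unit)
        (fun _ ω => ω / (1 : ℝ) ^ 2) (fun _ ω => ω / 4 / (1 / 2 : ℝ) ^ 2) fun _ => (1 : ℝ))
      (fun _ _ _ => histShell ((volume : Measure ℝ).restrict (Icc (0 : ℝ) 1)) ({()} : Finset Unit)
        (fun _ ω => ω / 4 / (1 / 2 : ℝ) ^ 2) (fun _ ω => ω / (1 : ℝ) ^ 2) fun _ => (1 : ℝ))
      (fun _ => ∑ _s ∈ ({()} : Finset Unit), (0 : ℝ) * 0 + ∑ _s ∈ ({()} : Finset Unit), (0 : ℝ) * 0) := by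
  haveI : IsFiniteMeasure ((volume : Measure ℝ).restrict (Icc (0 : ℝ) 1)) := isFiniteMeasure_unitInterval
  -- the window (W1): depth 0, one slot per level
  have hLW : LiveWindow (fun _ : ℕ => ({()} : Finset Unit)) (fun K _ => K) 0 1 :=
    ⟨fun K _ _ => le_rfl, fun K _ _ => le_rfl, fun K j => by
      have h := Finset.card_filter_le ({()} : Finset Unit) (fun _ => K = j)
      rw [Finset.card_singleton] at h
      exact_mod_cast h⟩
  -- the normalised variables coincide
  have hsync : ∀ ω : ℝ, |ω / (1 : ℝ) ^ 2 - ω / 4 / (1 / 2 : ℝ) ^ 2| ≤ 0 * 1 := fun ω => by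
    have : ω / (1 : ℝ) ^ 2 - ω / 4 / (1 / 2 : ℝ) ^ 2 = 0 := by ring
    rw [this, abs_zero, zero_mul]
  have hsync' : ∀ ω : ℝ, |ω / 4 / (1 / 2 : ℝ) ^ 2 - ω / (1 : ℝ) ^ 2| ≤ 0 * 1 := fun ω => by rw [abs_sub_comm]; exact hsync ω
  exact shellWeightBound_histories_fine_age (Ω := fun _ => ℝ) (σ := Unit) (ι := Unit)
    (T := fun _ => ({()} : Finset Unit)) (C := fun _ => ({()} : Finset Unit)) (small := fun _ _ => ({()} : Finset Unit))
    (lvl := fun K _ => K) (νA := fun _ _ _ => (volume : Measure ℝ).restrict (Icc (0 : ℝ) 1))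
    (νB := fun _ _ _ => (volume : Measure ℝ).restrict (Icc (0 : ℝ) 1)) (vA := fun _ _ _ ω => ω)
    (vB := fun _ _ _ ω => ω / 4) (ηA := fun _ _ => (1 : ℝ)) (ηB := fun _ _ => (1 / 2 : ℝ)) (ρ := fun _ => (0 : ℝ))
    (DA := fun _ => (0 : ℝ)) (DB := fun _ => (0 : ℝ)) (l₀ := 1) (N₁ := 0) (νbar := 1) (Dbar := 0) (c₁ := 0)
    (ϑ := 1 / 2) (ε := fun _ => (1 : ℝ))
    (fun _ _ _ => measurable_id) (fun _ _ _ => measurable_id.div_const 4) (fun _ _ => one_pos)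
    (fun _ _ => by norm_num) (fun _ _ _ => Finset.Subset.refl _)
    (fun K t _ τ _ s _ => Eventually.of_forall fun ω => hsync ω)
    (fun K t _ τ _ s _ => Eventually.of_forall fun ω => hsync' ω)
    (fun _ => le_rfl) (fun _ => le_rfl) (fun _ => le_rfl)
    (fun K t _ s _ => slotAntiConcentration_width_zero _ _ _ _)
    (fun K t _ s _ => slotAntiConcentration_width_zero _ _ _ _)
    hLW (by norm_num) (by norm_num) (fun _ => le_rfl) (fun _ => le_rfl) (fun j => by positivity)

/-- … WHEREAS THE RAW-CURRENCY CLOSENESS FAILS ON THE TOY at every width `≤ 1∕4`, e.g. `1∕4`: the raw variables `ω` and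
`ω∕4` are not `¼·1`-close a.e. on the unit interval (S90 `fineCurrency_closeness_fails` BY NAME: the shell `[3∕4, 1)`
has mass `1∕4`). [folklore] -/
theorem toy_raw_closeness_fails :
    ¬ ∀ᵐ ω ∂((volume : Measure ℝ).restrict (Icc (0 : ℝ) 1)), |ω - ω / 4| ≤ 1 / 4 * 1 := by
  refine ShellMeasureThresholdUnits.fineCurrency_closeness_fails (μ := (volume : Measure ℝ).restrict (Icc (0 : ℝ) 1))
    (uA := fun ω => ω) one_pos le_rfl (by norm_num) ?_
  have hset : {x : ℝ | 1 * (1 - 1 / 4) ≤ x ∧ x < 1} = Ico (3 / 4 : ℝ) 1 := by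
    ext x; simp only [mem_setOf_eq, Set.mem_Ico]; norm_num
  have hsub : Ico (3 / 4 : ℝ) 1 ⊆ Icc (0 : ℝ) 1 := fun x hx => ⟨by linarith [hx.1], hx.2.le⟩
  rw [hset, Measure.restrict_apply measurableSet_Ico, inter_eq_left.2 hsub, Real.volume_Ico]; norm_num

end Toy

end Summit.QuantumFields.BalabanUV.T4Continuum.ShellMeasureRootCompositionHistoriesFine

end
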